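import Summits.FinalStateConjecture.FinalStateConjecture.Theses.KerrnessPropagates
import Literature.Geometry.Lorentzian.BilinPullbackEstimates
import Literature.Geometry.Lorentzian.MultiCentreRadiationZone
import Literature.Geometry.Lorentzian.KerrCollarConvergence

/-!
# Route `KerrnessPropagates`, crux `KerrBasinCapture` (stmt-FinalStateConjecture-17646), line `registered`
# (skeleton `Cruxes/KerrBasinCapture/Lines/birth.lean`, lead rev 7) — stub `stub_transferChart`

The transferred (precomposed) hand-over slab chart.

A hand-over slab of the capture statement is a smooth open embedding `Φ : U → 𝒟` of a
neighbourhood `U ⊆ ℝ⁴` of the punctured hyperplane `{x⁰ = τ, rₙⱼ > r₀ₙ j}` (radii measured in the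
Kerr–Schild frames of the configuration `n`). Given a smooth time-preserving map `Θ : ℝ⁴ → ℝ⁴`
which is an open embedding of the slab `{|x⁰ − τ| < 1}` and maps the punctured hyperplane of a
second ("limit") configuration `l` into that of `n`, this file packages the soft facts about the
precomposed chart `Φ ∘ θ`, where `θ : U' → U` is the corestriction of `Θ` to
`U' := {|x⁰ − τ| < 1} ∩ Θ⁻¹ U ∩ {rₗⱼ > r₀ₗ j}`:

* `U'` is open and `θ` is smooth with `dθ = DΘ` (maps between open subsets of `ℝ⁴` are
  differentiated through representatives, `OpensChart.mfderiv_eq`), so `Φ ∘ θ` is smooth and the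
  chain rule reads `d(Φ ∘ θ)_x v = dΦ_{θ x} (DΘ(x) v)`;
* `θ` is an open embedding (restriction of the open embedding `Θ|{|x⁰ − τ| < 1}` to the open subset
  `U'`), hence so is `Φ ∘ θ`;
* `U'` contains the limit punctured hyperplane, `range (Φ ∘ θ) ⊆ range Φ ⊆ J⁺(Σ)`, and the image of
  the slab `{x⁰ = τ} ∩ U'` is a subset of the (achronal) image of `{x⁰ = τ} ∩ U` because `Θ`
  preserves `x⁰`; achronality is antitone;
* the junk-extended metric deviation of `Φ ∘ θ` from an arbitrary reference form `Bg'` on `U'` is,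
  near every point of `U'`, the coordinate pullback `bilinPullback Θ` of `(deviation of Φ from Bg) + Bg`
  (i.e. of the components `Φ^* g` on `U`) minus `Bg'` — the transformation law of a covariant
  `2`-tensor under the coordinate change `Θ` (O'Neill 1983, Ch. 3, Def. 3.9).

Everything is elementary; no definitions, no named facts.
-/

open scoped BigOperators Topology Manifold Classical Matrix InnerProductSpace ContinuousMap
open Filter Set Function TopologicalSpace
open Literature.Geometry.Lorentzian

-- D-0017: single-problem summit, `Summit.<S>.<S>.…` by design.
set_option linter.dupNamespace false

namespace Summit.FinalStateConjecture.FinalStateConjecture.Theorems.KerrnessPropagates.KerrBasinCapture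

namespace TransferChart

variable {E : Type*} [NormedAddCommGroup E] [NormedSpace ℝ E] {U U' : Opens E} {θ : U' → U}
  {Θ : E → E}

/-- A map `θ : U' → U` between open subsets of a normed space whose representative `Θ`
(`(θ x : E) = Θ x`) is smooth is smooth as a map of manifolds. [folklore] -/
theorem contMDiff_of_val_eq (hθ : ∀ x, ((θ x : U) : E) = Θ x) (hΘ : ContDiff ℝ (⊤ : ℕ∞) Θ) :
    ContMDiff 𝓘(ℝ, E) 𝓘(ℝ, E) (⊤ : ℕ∞) θ := by
  refine (ContMDiff.subtypeVal_comp_iff _ _).1 ?_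
  have h : Subtype.val ∘ θ = fun x : U' ↦ Θ (x : E) := funext hθ
  rw [h]
  exact hΘ.contMDiff.comp contMDiff_subtype_val

/-- The differential of a map `θ : U' → U` between open subsets of a normed space is the Fréchet
derivative of its representative: `dθ_x v = DΘ(x) v`. [folklore] -/
theorem mfderiv_apply_of_val_eq (hθ : ∀ x, ((θ x : U) : E) = Θ x) {x : U'}
    (hΘ : DifferentiableAt ℝ Θ x) (v : TangentSpace 𝓘(ℝ, E) x) :
    mfderiv 𝓘(ℝ, E) 𝓘(ℝ, E) θ x v = fderiv ℝ Θ x v := by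
  -- adapted from `OpensChart.mfderiv_apply_of_repr` (ChartSecondFundamentalForm.lean)
  have h1 : MDifferentiableAt 𝓘(ℝ, E) 𝓘(ℝ, E) (Subtype.val ∘ θ) x :=
    (OpensChart.mdifferentiableAt_iff x (Subtype.val ∘ θ) Θ hθ).2 hΘ
  have hfd : MDifferentiableAt 𝓘(ℝ, E) 𝓘(ℝ, E) θ x :=
    (ChartedSpace.liftPropWithinAt_subtypeVal_comp_iff θ univ x).mp h1
  have hval : MDifferentiableAt 𝓘(ℝ, E) 𝓘(ℝ, E) (Subtype.val : U → E) (θ x) :=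
    (OpensChart.mdifferentiableAt_iff (θ x) Subtype.val id (fun _ ↦ rfl)).2 differentiableAt_id
  have h2 : mfderiv 𝓘(ℝ, E) 𝓘(ℝ, E) (Subtype.val : U → E) (θ x) = ContinuousLinearMap.id ℝ E := by
    rw [OpensChart.mfderiv_eq (θ x) Subtype.val id (fun _ ↦ rfl) differentiableAt_id, fderiv_id]
  have h3 : mfderiv 𝓘(ℝ, E) 𝓘(ℝ, E) (Subtype.val ∘ θ) x = fderiv ℝ Θ x :=
    OpensChart.mfderiv_eq x (Subtype.val ∘ θ) Θ hθ hΘ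
  have h4 := DFunLike.congr_fun (mfderiv_comp x hval hfd) v
  rw [h3, h2] at h4
  exact h4.symm

omit [NormedSpace ℝ E] in
/-- A map `θ : U' → U` between open subsets whose representative `Θ` restricts to an open
embedding on a set `s ⊇ U'` is an open embedding (`U'` is open in `s`, so the inclusion `U' → s` is
an open embedding, and `Subtype.val ∘ θ = Θ|s ∘ (U' ↪ s)`). [folklore] -/
theorem isOpenEmbedding_of_val_eq (hθ : ∀ x, ((θ x : U) : E) = Θ x) {s : Set E}
    (hsub : (U' : Set E) ⊆ s) (hΘ : Topology.IsOpenEmbedding (s.restrict Θ)) :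
    Topology.IsOpenEmbedding θ := by
  have hj : Topology.IsOpenEmbedding (Set.inclusion hsub) :=
    Topology.IsOpenEmbedding.inclusion hsub (U'.isOpen.preimage continuous_subtype_val)
  have heq : (Subtype.val : U → E) ∘ θ = s.restrict Θ ∘ Set.inclusion hsub := funext hθ
  exact Topology.IsOpenEmbedding.of_comp θ U.isOpen.isOpenEmbedding_subtypeVal (heq ▸ hΘ.comp hj)

end TransferChart

/-- stub_transferChart — the transferred (precomposed) chart (registered stub of crux
stmt-FinalStateConjecture-17646, line `registered`): precomposing a hand-over slab chart `Φ : U → 𝒟`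
with the corestriction `θ : U' → U` of a smooth time-preserving open embedding `Θ` of the slab
`{|x⁰ − τ| < 1}` yields a smooth open embedding `Φ ∘ θ` covering the limit punctured hyperplane,
with range in `J⁺(Σ)`, achronal slab image, the chain rule `d(Φ ∘ θ) = dΦ ∘ DΘ`, and the
tensor transformation law for the metric deviation (O'Neill 1983, Ch. 3, Def. 3.9). [folklore] -/
theorem stub_transferChart : ∀ k : ℕ, ∀ (X : Type) [TopologicalSpace X] [ChartedSpace E3 X] [IsManifold (𝓡 3) (⊤ : ℕ∞) X] [T2Space X] [SecondCountableTopology X] [ConnectedSpace X] (D : InitialDataSet (𝓡 3) X) (𝒟 : VacuumCauchyDevelopment D) (N : ℕ) (aₙ r₀ₙ : Fin N → ℝ) (moₙ : Fin N → ↥lorentzGroup × E4) (aₗ r₀ₗ : Fin N → ℝ) (moₗ : Fin N → ↥lorentzGroup × E4) (τ : ℝ) (U : Opens E4) (Φ : U → 𝒟.carrier) (Θ : E4 → E4), ContMDiff 𝓘(ℝ, E4) (𝓡 4) (⊤ : ℕ∞) Φ → Topology.IsOpenEmbedding Φ → {x : E4 | x 0 = τ ∧ ∀ j, r₀ₙ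 j < Kerr.radius (aₙ j) (poincareInv (moₙ j).1 (moₙ j).2 x)} ⊆ (U : Set E4) → range Φ ⊆ 𝒟.metric.causalFuture 𝒟.timeOrientation (range 𝒟.embed) → 𝒟.metric.IsAchronal 𝒟.timeOrientation (Φ '' {x : ↥U | (x : E4) 0 = τ}) → ContDiff ℝ (⊤ : ℕ∞) Θ → (∀ x, (Θ x) 0 = x 0) → Topology.IsOpenEmbedding ({x : E4 | |x 0 - τ| < 1}.restrict Θ) → (∀ x : E4, x 0 = τ → (∀ j, r₀ₗ j < Kerr.radius (aₗ j) (poincareInv (moₗ j).1 (moₗ j).2 x)) → ∀ j, r₀ₙ j < Kerr.radius (aₙ j) (poincareInv (moₙ j).1 (moₙ j).2 (Θ x))) → ∃ (U' : Opens E4) (θ : U' → U), (U' : Set E4) = {x : E4 | |x 0 - τ| < 1} ∩ Θ ⁻¹' (U : Set E4) ∩ {x : E4 | ∀ j, r₀ₗ j < Kerr.radius (aₗ j) (poincareInv (moₗ j).1 (moₗ j).2 x)} ∧ (∀ x : U', ((θ x : U) : E4) = Θ x) ∧ ContMDiff 𝓘(ℝ, E4) (𝓡 4) (⊤ : ℕ∞)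 (Φ ∘ θ) ∧ Topology.IsOpenEmbedding (Φ ∘ θ) ∧ {x : E4 | x 0 = τ ∧ ∀ j, r₀ₗ j < Kerr.radius (aₗ j) (poincareInv (moₗ j).1 (moₗ j).2 x)} ⊆ (U' : Set E4) ∧ range (Φ ∘ θ) ⊆ 𝒟.metric.causalFuture 𝒟.timeOrientation (range 𝒟.embed) ∧ 𝒟.metric.IsAchronal 𝒟.timeOrientation ((Φ ∘ θ) '' {x : ↥U' | (x : E4) 0 = τ}) ∧ (∀ x : U', ∀ v : E4, mfderiv 𝓘(ℝ, E4) (𝓡 4) (Φ ∘ θ) x v = mfderiv 𝓘(ℝ, E4) (𝓡 4) Φ (θ x) (fderiv ℝ Θ x v)) ∧ (∀ (Bg Bg' : E4 → E4 →L[ℝ] E4 →L[ℝ] ℝ) (tm tm' rd rd' : E4 → ℝ) (x : U'), 𝒟.toSpacetime.deviationExtend ⟨U', Bg', tm', rd'⟩ (Φ ∘ θ) =ᶠ[𝓝 (x : E4)] fun y ↦ bilinPullback Θ (fun z ↦ 𝒟.toSpacetime.deviationExtend ⟨U, Bg, tm, rd⟩ Φ z + Bg z) y - Bg' y) := by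
  intro k X _ _ _ _ _ _ D 𝒟 N aₙ r₀ₙ moₙ aₗ r₀ₗ moₗ τ U Φ Θ hΦ hemb hU hJ hachr hΘ htime hΘemb hmaps
  have hc0 : Continuous fun y : E4 ↦ y 0 := PiLp.continuous_apply 2 _ 0
  have hslab : IsOpen {x : E4 | |x 0 - τ| < 1} :=
    isOpen_lt (hc0.sub continuous_const).abs continuous_const
  have hrad :
      IsOpen {x : E4 | ∀ j, r₀ₗ j < Kerr.radius (aₗ j) (poincareInv (moₗ j).1 (moₗ j).2 x)} := by
    rw [Set.setOf_forall]
    exact isOpen_iInter_of_finite fun j ↦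
      isOpen_lt continuous_const ((Kerr.continuous_radius _).comp (continuous_poincareInv _ _))
  have hS : IsOpen ({x : E4 | |x 0 - τ| < 1} ∩ Θ ⁻¹' (U : Set E4) ∩
      {x : E4 | ∀ j, r₀ₗ j < Kerr.radius (aₗ j) (poincareInv (moₗ j).1 (moₗ j).2 x)}) :=
    (hslab.inter (U.isOpen.preimage hΘ.continuous)).inter hrad
  set U' : Opens E4 := ⟨_, hS⟩
  set θ : U' → U := fun x ↦ ⟨Θ x, x.2.1.2⟩
  have hθval : ∀ x, ((θ x : U) : E4) = Θ x := fun _ ↦ rfl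
  have hsub : (U' : Set E4) ⊆ {x : E4 | |x 0 - τ| < 1} := fun x hx ↦ hx.1.1
  have hθs : ContMDiff 𝓘(ℝ, E4) 𝓘(ℝ, E4) (⊤ : ℕ∞) θ := TransferChart.contMDiff_of_val_eq hθval hΘ
  have hθe : Topology.IsOpenEmbedding θ :=
    TransferChart.isOpenEmbedding_of_val_eq hθval hsub hΘemb
  have hchain : ∀ x : U', ∀ v : E4, mfderiv 𝓘(ℝ, E4) (𝓡 4) (Φ ∘ θ) x v =
      mfderiv 𝓘(ℝ, E4) (𝓡 4) Φ (θ x) (fderiv ℝ Θ x v) := by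
    intro x v
    have hΦd : MDifferentiableAt 𝓘(ℝ, E4) (𝓡 4) Φ (θ x) := hΦ.mdifferentiableAt (by simp)
    have hθd : MDifferentiableAt 𝓘(ℝ, E4) 𝓘(ℝ, E4) θ x := hθs.mdifferentiableAt (by simp)
    have h := DFunLike.congr_fun (mfderiv_comp x hΦd hθd) v
    exact h.trans (congrArg (mfderiv 𝓘(ℝ, E4) (𝓡 4) Φ (θ x))
      (TransferChart.mfderiv_apply_of_val_eq hθval
        ((hΘ.differentiable (by simp)).differentiableAt) v))
  refine ⟨U', θ, rfl, hθval, hΦ.comp hθs, hemb.comp hθe, ?_, ?_, ?_, hchain, ?_⟩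
  · -- the limit punctured hyperplane lies in `U'`
    rintro x ⟨hx0, hxr⟩
    refine ⟨⟨?_, ?_⟩, hxr⟩
    · show |x 0 - τ| < 1
      rw [hx0, sub_self, abs_zero]
      exact one_pos
    · exact hU ⟨(htime x).trans hx0, hmaps x hx0 hxr⟩
  · -- range in `J⁺(Σ)`
    exact (Set.range_comp_subset_range θ Φ).trans hJ
  · -- achronal slab image
    have himg : (Φ ∘ θ) '' {x : ↥U' | (x : E4) 0 = τ} ⊆ Φ '' {x : ↥U | (x : E4) 0 = τ} := by
      rintro _ ⟨x, hx, rfl⟩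
      refine ⟨θ x, ?_, rfl⟩
      show (Θ x) 0 = τ
      rw [htime]
      exact hx
    exact fun p hp q hq ↦ hachr p (himg hp) q (himg hq)
  · -- the transformation law of the metric deviation
    intro Bg Bg' tm tm' rd rd' x
    filter_upwards [U'.isOpen.mem_nhds x.2] with y hy
    have hL : 𝒟.toSpacetime.deviationExtend ⟨U', Bg', tm', rd'⟩ (Φ ∘ θ) y =
        𝒟.toSpacetime.deviation ⟨U', Bg', tm', rd'⟩ (Φ ∘ θ) ⟨y, hy⟩ :=
      Spacetime.deviationExtend_coe 𝒟.toSpacetime ⟨U', Bg', tm', rd'⟩ (Φ ∘ θ) ⟨y, hy⟩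
    have hR : 𝒟.toSpacetime.deviationExtend ⟨U, Bg, tm, rd⟩ Φ (Θ y) =
        𝒟.toSpacetime.deviation ⟨U, Bg, tm, rd⟩ Φ (θ ⟨y, hy⟩) :=
      Spacetime.deviationExtend_coe 𝒟.toSpacetime ⟨U, Bg, tm, rd⟩ Φ (θ ⟨y, hy⟩)
    rw [hL]
    ext v w
    simp only [sub_apply, add_apply, bilinPullback_apply]
    rw [hR, Spacetime.deviation_apply, Spacetime.deviation_apply, hchain ⟨y, hy⟩ v,
      hchain ⟨y, hy⟩ w]
    change _ = _ - Bg (Θ y) (fderiv ℝ Θ y v) (fderiv ℝ Θ y w) +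
      Bg (Θ y) (fderiv ℝ Θ y v) (fderiv ℝ Θ y w) - Bg' y v w
    rw [sub_add_cancel]
    rfl

end Summit.FinalStateConjecture.FinalStateConjecture.Theorems.KerrnessPropagates.KerrBasinCapture
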